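import Summits.CriticalPhenomena.PercolationContinuityZ3.Theorems.PercNearOneGluingNoHeavyQuantBlobDecTwoLawParts
import HarnessLib

/-!
# QUANT lane R8, T-DEC: BLOB-DEC(2) AT LAW LEVEL, part II — class aB, the window theorem and DEC(j′) at EVERY layer
# for the law of two independent heavy blobs (`Quant.LawDec.DECAt`; the first kernel rung of `Quant.TreeDEC` inside the window)

builds on p205010 (kernel theorem, internal audit signed; external expert review pending)

Support file (`--supports stmt-CriticalPhenomena-4575`), QUANT lane seat prim-quant-census-2 (gen 52), rung R8 of
`run/shared/lean/prim/quant/LADDER.md`; continues part I (`…QuantBlobDecTwoLawParts`: the law `LAW2[a,u,b,v]`, the six-component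
assembly `BlobDec2.decAt_of_six`, classes G / tied-one / AB).  Memos: `prim-quant-census-2-g51/BLOB-DEC2-G51.md` §1–2,
`prim-quant-census-2-g52/BLOB-DEC2-LAW-G52.md`.  Theorems only (no definitions), standard axioms.

* `BlobDec2.decAt_classaB` — CLASS aB (`1 ≤ a ≤ b ≤ j′ < a+b`, `v < 1`, `2a < T = au + bv`): lows `0, a`, mid `b`, giant `a+b`.
  GREEDY's flows (BLOB-DEC2-G51 §1.2): with `K_G = uv(1−y)/y` (giant capacity in low-mass units) and residual `r = (1−v) − K_G`,
  atom `a` sends `z₃ = [min(r, u(1−v))]⁺` to the mid through the credit pair `{a, b; γ}` (`γ = max(ρ, y²+(1−y)ρ)`,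
  `ρ = (T−2a)/(b−a)`), atom `0` sends `z₄ = [r − u(1−v)]⁺` through `{0, b; T/b}`, everything else rides with the giant at gate `y`
  (`{0, a+b; y}`, `{a, a+b; y}`); the mid mass used, `γ/(1−γ)·z₃ + T/(b−T)·z₄`, fits in `(1−u)v` by `BlobDec2.classaB`, and the giant
  mass used is `y/(1−y)·((1−v) − r⁺) ≤ uv`.  (`z₄ > 0` forces `u, v < 1/2`, hence `T < b`: `lt_half_of_subcase_two`.)
* **`BlobDec2.decAt_window`** — for ALL sizes `a, b ≥ 1`, floor `0 < y < 1`, gates `u, v ∈ [y, 1]` and every layer `j′ < a + b`: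
  `Quant.LawDec.DECAt y j′ (a+b) LAW2[a,u,b,v]` (classes G | tied-one | AB | aB after ordering the sizes; NO window hypothesis
  `T ≤ 2j′` is needed: `b ≤ j′` already gives `T ≤ a + b ≤ 2j′`, and `j′ < b` is class G, which contains the dominant layers).
* **`BlobDec2.decAt_all`** — the same at EVERY layer `j′`: above the top (`j′ ≥ a+b`) by Theorem A (`LawDec.decAt_of_top_le`,
  atoms affordable since `y(a+b) ≤ au + bv`).  This is Conjecture `Quant.TreeDEC`'s conclusion for the forest "two leaves of
  multiplicities `a, b` under the root" at law level, including the dominant layers it excludes.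

HONEST STATUS.  BLOB-DEC for `k ≥ 3` blobs and T-DEC on trees remain conjectures (`Quant.TreeDEC`; GREEDY-DEC 0 / ≈ 97 M); nothing
here changes a rate or the lane's honest sentence.
[this work]; LP semantics BLOB-DEC2-G51 §1, DEC rules ARCH-TREES-G49 §2.2 / DEC-TAMP-G50 §3.1 (this lane).  The gluing rows served
[cite: KozmaNitzan2024, Conjecture 3 (p. 15)]; product measure [cite: Grimmett1999, §1.3 p. 10].
-/

noncomputable section

namespace Summit.CriticalPhenomena.PercolationContinuityZ3.Theorems

namespace Quant

open Finset

/-- the two-point law `{lo, hi; g}` (as in `…QuantLawDEC`) -/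
local notation3 "TP[" lo ", " hi ", " g ", " h "]" =>
  (g : ℝ) * (if (h : ℕ) = (hi : ℕ) then (1 : ℝ) else 0) + (1 - (g : ℝ)) * (if (h : ℕ) = (lo : ℕ) then (1 : ℝ) else 0)

/-- the two-blob law `(1−u)(1−v)δ₀ + u(1−v)δ_a + (1−u)vδ_b + uvδ_{a+b}` evaluated at `h` (as in part I) -/
local notation3 "LAW2[" a ", " u ", " b ", " v ", " h "]" =>
  (1 - (u : ℝ)) * (1 - (v : ℝ)) * (if (h : ℕ) = 0 then (1 : ℝ) else 0)
    + (u : ℝ) * (1 - (v : ℝ)) * (if (h : ℕ) = (a : ℕ) then (1 : ℝ) else 0)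
    + (1 - (u : ℝ)) * (v : ℝ) * (if (h : ℕ) = (b : ℕ) then (1 : ℝ) else 0)
    + (u : ℝ) * (v : ℝ) * (if (h : ℕ) = (a : ℕ) + (b : ℕ) then (1 : ℝ) else 0)

namespace BlobDec2

/-! ### Class aB -/

/-- The credit pair `{a, b; γ}` at its minimal credit gate `γ = max(ρ, y² + (1−y)ρ)`, `ρ = (T − 2a)/(b − a)`, into the mid
`b ≤ j′` is valid (rule (N)): heavy `γ ≥ ρ` gives credit `2a + (b−a)γ ≥ T`; light `γ < y` gives discounted rate
`(γ − y²)/(1−y) ≥ ρ`. [this work] -/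
theorem validAt_pair (y T ρ γ : ℝ) (j' a b : ℕ) (hab : a < b) (hbj : b ≤ j') (hy1 : y < 1)
    (hρ : ρ = (T - 2 * (a : ℝ)) / ((b : ℝ) - a)) (hγ : γ = max ρ (y ^ 2 + (1 - y) * ρ)) :
    LawDec.ValidAt y T j' a b γ := by
  refine Or.inr (Or.inr ⟨hab, hbj, ?_⟩)
  have hba : (0 : ℝ) < (b : ℝ) - a := by
    have : (a : ℝ) < b := by exact_mod_cast hab
    linarith
  have hρT : ((b : ℝ) - a) * ρ = T - 2 * (a : ℝ) := by
    rw [hρ, mul_div_cancel₀ _ hba.ne']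
  have hrate : ρ ≤ (if y ≤ γ then γ else (γ - y ^ 2) / (1 - y)) := by
    split_ifs with hyγ
    · rw [hγ]; exact le_max_left _ _
    · have h1y : 0 < 1 - y := by linarith
      rw [le_div_iff₀ h1y]
      have : y ^ 2 + (1 - y) * ρ ≤ γ := by rw [hγ]; exact le_max_right _ _
      linarith
  have := mul_le_mul_of_nonneg_left hrate hba.le
  linarith

/-- Sub-case 2 of class aB (`uv(1−y)/y < (1−u)(1−v)`, i.e. the giant cannot take all of atom `0`) forces both gates below `1/2`
(BLOB-DEC2-G51 §2.4 (a)): if `u ≥ 1/2` then `1−u ≤ u` and `y(1−v) ≤ (1−y)v`, whose product contradicts the hypothesis.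
[this work] -/
theorem lt_half_of_subcase_two (u v y : ℝ) (hy : 0 < y) (hyu : y ≤ u) (hyv : y ≤ v) (hu1 : u ≤ 1) (hv1 : v ≤ 1)
    (h2 : u * v * ((1 - y) / y) < (1 - u) * (1 - v)) : u < 1 / 2 ∧ v < 1 / 2 := by
  have h2' : u * v * (1 - y) < y * ((1 - u) * (1 - v)) := by
    have h := mul_lt_mul_of_pos_left h2 hy
    have e : y * (u * v * ((1 - y) / y)) = u * v * (1 - y) := by
      field_simp
    linarith
  constructor
  · by_contra hu
    have hu' : 1 - u ≤ u := by linarith [not_lt.1 hu]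
    have hv' : y * (1 - v) ≤ (1 - y) * v := by nlinarith
    have h3 : y * ((1 - u) * (1 - v)) ≤ u * v * (1 - y) :=
      calc y * ((1 - u) * (1 - v)) = (1 - u) * (y * (1 - v)) := by ring
        _ ≤ u * ((1 - y) * v) := mul_le_mul hu' hv' (mul_nonneg hy.le (by linarith)) (by linarith)
        _ = u * v * (1 - y) := by ring
    linarith
  · by_contra hv
    have hv' : 1 - v ≤ v := by linarith [not_lt.1 hv]
    have hu' : y * (1 - u) ≤ (1 - y) * u := by nlinarith
    have h3 : y * ((1 - u) * (1 - v)) ≤ u * v * (1 - y) :=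
      calc y * ((1 - u) * (1 - v)) = (1 - v) * (y * (1 - u)) := by ring
        _ ≤ v * ((1 - y) * u) := mul_le_mul hv' hu' (mul_nonneg hy.le (by linarith)) (by linarith)
        _ = u * v * (1 - y) := by ring
    linarith

/-- **Class aB (`a ≤ b ≤ j′`, `j′ + 1 ≤ a + b`, `v < 1`, `2a < T = au + bv`; then `a < b`).**  GREEDY's flows, see the file header;
the mid fits by `BlobDec2.classaB`, the giant by the residual bookkeeping `z₃ + z₄ = r⁺`. [this work] -/
theorem decAt_classaB (a b j' : ℕ) (u v y : ℝ) (ha : 0 < a) (hab : a ≤ b) (hbj : b ≤ j') (hjab : j' + 1 ≤ a + b)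
    (hy : 0 < y) (hy1 : y < 1) (hyu : y ≤ u) (hyv : y ≤ v) (hu1 : u ≤ 1) (hv1 : v < 1)
    (haB : 2 * (a : ℝ) < a * u + b * v) :
    LawDec.DECAt y j' (a + b) (fun h => LAW2[a, u, b, v, h]) := by
  obtain ⟨T, hT⟩ : ∃ T : ℝ, T = a * u + b * v := ⟨_, rfl⟩
  rw [← hT] at haB
  have hupos : 0 < u := lt_of_lt_of_le hy hyu
  have hvpos : 0 < v := lt_of_lt_of_le hy hyv
  have ha' : (0 : ℝ) < a := by exact_mod_cast ha
  have hab' : (a : ℝ) ≤ b := by exact_mod_cast hab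
  have hb : 0 < b := lt_of_lt_of_le ha hab
  have hb' : (0 : ℝ) < b := by exact_mod_cast hb
  have h1y : 0 < 1 - y := by linarith
  have hTpos : 0 < T := by linarith
  have hTab : T ≤ a + b := by rw [hT]; nlinarith
  have hlt' : (a : ℝ) < b := by
    by_contra hle
    have hba : (b : ℝ) = a := le_antisymm (not_lt.1 hle) hab'
    rw [hT, hba] at haB
    nlinarith
  have hlt : a < b := by exact_mod_cast hlt'
  have hyTb : y * b ≤ T := by rw [hT]; nlinarith [mul_le_mul_of_nonneg_left hyv hb'.le, mul_nonneg ha'.le hupos.le]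
  have p0n : 0 ≤ (1 - u) * (1 - v) := mul_nonneg (by linarith) (by linarith)
  have pan : 0 ≤ u * (1 - v) := mul_nonneg hupos.le (by linarith)
  have pbn : 0 ≤ (1 - u) * v := mul_nonneg (by linarith) hvpos.le
  -- the credit gate of the pair `(a, b)`
  obtain ⟨ρ, hρ⟩ : ∃ ρ : ℝ, ρ = (T - 2 * (a : ℝ)) / ((b : ℝ) - a) := ⟨_, rfl⟩
  obtain ⟨γ, hγ⟩ : ∃ γ : ℝ, γ = max ρ (y ^ 2 + (1 - y) * ρ) := ⟨_, rfl⟩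
  have hρ0 : 0 ≤ ρ := by rw [hρ]; exact div_nonneg (by linarith) (by linarith)
  have hρv : ρ ≤ v := by rw [hρ]; exact rho_le u v a b T hu1 hv1.le ha'.le hlt' hT
  have hγ0 : 0 ≤ γ := le_trans hρ0 (by rw [hγ]; exact le_max_left _ _)
  have hγv : γ ≤ v := by
    rw [hγ]
    refine max_le hρv ?_
    nlinarith [mul_le_mul_of_nonneg_left hρv h1y.le, mul_le_mul_of_nonneg_left hyv hy.le]
  have hγ1 : γ < 1 := lt_of_le_of_lt hγv hv1
  have h1γ : 0 < 1 - γ := by linarith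
  -- the residual after the giant, and GREEDY's flows into the mid
  obtain ⟨K, hK⟩ : ∃ K : ℝ, K = u * v * ((1 - y) / y) := ⟨_, rfl⟩
  have hKn : 0 ≤ K := by rw [hK]; exact mul_nonneg (mul_nonneg hupos.le hvpos.le) (div_nonneg h1y.le hy.le)
  obtain ⟨r, hr⟩ : ∃ r : ℝ, r = (1 - v) - K := ⟨_, rfl⟩
  obtain ⟨z₃, hz₃⟩ : ∃ z : ℝ, z = max (min r (u * (1 - v))) 0 := ⟨_, rfl⟩
  obtain ⟨z₄, hz₄⟩ : ∃ z : ℝ, z = max (r - u * (1 - v)) 0 := ⟨_, rfl⟩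
  have hz₃n : 0 ≤ z₃ := by rw [hz₃]; exact le_max_right _ _
  have hz₄n : 0 ≤ z₄ := by rw [hz₄]; exact le_max_right _ _
  have hz₃le : z₃ ≤ u * (1 - v) := by rw [hz₃]; exact max_le (min_le_right _ _) pan
  have hz₄le : z₄ ≤ (1 - u) * (1 - v) := by
    rw [hz₄]; refine max_le ?_ p0n; rw [hr]; nlinarith
  have hz34 : z₃ + z₄ = max r 0 := by
    rw [hz₃, hz₄]
    rcases le_total r 0 with hr0 | hr0
    · rw [max_eq_right hr0, max_eq_right (le_trans (min_le_left _ _) hr0), max_eq_right (by linarith [pan]), add_zero]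
    · rw [max_eq_left hr0]
      rcases le_total r (u * (1 - v)) with hrp | hrp
      · rw [min_eq_left hrp, max_eq_left hr0, max_eq_right (by linarith), add_zero]
      · rw [min_eq_right hrp, max_eq_left pan, max_eq_left (by linarith)]; ring
  -- a charged pair `{0, b; T/b}` means sub-case 2, hence `T < b`
  have hz₄pos : 0 < z₄ → T < b := by
    intro hz
    have hr2 : u * (1 - v) < r := by
      by_contra hle
      rw [hz₄, max_eq_right (by linarith [not_lt.1 hle])] at hz
      exact lt_irrefl _ hz
    have hsub : u * v * ((1 - y) / y) < (1 - u) * (1 - v) := by rw [hr, hK] at hr2; linarith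
    obtain ⟨hu2, hv2⟩ := lt_half_of_subcase_two u v y hy hyu hyv hu1 hv1.le hsub
    rw [hT]; nlinarith
  -- the mid mass used fits (BLOB-DEC2-G51 §2: `BlobDec2.classaB`)
  have hU : γ / (1 - γ) * z₃ + T / (b - T) * z₄ ≤ (1 - u) * v := by
    rcases le_or_gt 0 r with hr0 | hr0
    · have h := classaB u v a b T ρ y γ hy hyu hyv hu1 hv1 ha' hlt' hT haB.le hρ hγ
      have e3 : z₃ = min r (u * (1 - v)) := by rw [hz₃]; exact max_eq_left (le_min hr0 pan)
      rw [e3, hz₄, hr, hK]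
      exact h
    · have e3 : z₃ = 0 := by rw [hz₃]; exact max_eq_right (le_trans (min_le_left _ _) hr0.le)
      have e4 : z₄ = 0 := by rw [hz₄]; exact max_eq_right (by linarith [pan])
      rw [e3, e4, mul_zero, mul_zero, add_zero]; exact pbn
  -- components 1, 2: the giant pairs `{0, a+b; y}`, `{a, a+b; y}`
  obtain ⟨w₁, hw₁⟩ : ∃ w : ℝ, w = ((1 - u) * (1 - v) - z₄) / (1 - y) := ⟨_, rfl⟩
  obtain ⟨w₂, hw₂⟩ : ∃ w : ℝ, w = (u * (1 - v) - z₃) / (1 - y) := ⟨_, rfl⟩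
  have hw₁n : 0 ≤ w₁ := by rw [hw₁]; exact div_nonneg (by linarith) h1y.le
  have hw₂n : 0 ≤ w₂ := by rw [hw₂]; exact div_nonneg (by linarith) h1y.le
  have e₁ : (1 - y) * w₁ = (1 - u) * (1 - v) - z₄ := by rw [hw₁]; exact mul_div_cancel₀ _ h1y.ne'
  have e₂ : (1 - y) * w₂ = u * (1 - v) - z₃ := by rw [hw₂]; exact mul_div_cancel₀ _ h1y.ne'
  have c₁₂ : y * w₁ + y * w₂ ≤ u * v := by
    have hy0 : y ≠ 0 := ne_of_gt hy
    have hle : (1 - v) - max r 0 ≤ K := by rw [hr]; linarith [le_max_left ((1 - v) - K) 0]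
    calc y * w₁ + y * w₂ = y / (1 - y) * ((1 - v) - (z₃ + z₄)) := by rw [hw₁, hw₂]; field_simp; ring
      _ = y / (1 - y) * ((1 - v) - max r 0) := by rw [hz34]
      _ ≤ y / (1 - y) * K := mul_le_mul_of_nonneg_left hle (div_nonneg hy.le h1y.le)
      _ = u * v := by rw [hK]; field_simp
  -- component 3: the credit pair `{a, b; γ}`
  obtain ⟨w₃, hw₃⟩ : ∃ w : ℝ, w = z₃ / (1 - γ) := ⟨_, rfl⟩
  have hw₃n : 0 ≤ w₃ := by rw [hw₃]; exact div_nonneg hz₃n h1γ.le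
  have e₃ : (1 - γ) * w₃ = z₃ := by rw [hw₃]; exact mul_div_cancel₀ _ h1γ.ne'
  have m₃ : γ * w₃ = γ / (1 - γ) * z₃ := by rw [hw₃]; ring
  -- component 4: the credit pair `{0, b; T/b}`
  obtain ⟨g₄, w₄, hg₄, hw₄n, e₄, m₄, hv₄⟩ := mid_zero_comp T b z₄ y hTpos hyTb hz₄n hz₄pos
  have c₃₄ : γ * w₃ + g₄ * w₄ ≤ (1 - u) * v := by rw [m₃, m₄]; exact hU
  -- point components
  have hSb : T ≤ 2 * ((b : ℕ) : ℝ) := by linarith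
  have hSab : T ≤ 2 * ((a + b : ℕ) : ℝ) := by push_cast; linarith
  have hab0 : 0 < a + b := Nat.add_pos_left ha b
  subst hT
  exact decAt_of_six a b j' u v y w₁ w₂ w₃ w₄ ((1 - u) * v - γ * w₃ - g₄ * w₄) (u * v - y * w₁ - y * w₂)
    y y γ g₄ 1 1 0 a a 0 b (a + b) (a + b) (a + b) b b b (a + b)
    ⟨hw₁n, hw₂n, hw₃n, hw₄n, by linarith, by linarith⟩
    (by linear_combination e₁ + e₂ + e₃ + e₄)
    ⟨⟨hy.le, hy1.le⟩, ⟨hy.le, hy1.le⟩, ⟨hγ0, hγ1.le⟩, hg₄, ⟨zero_le_one, le_rfl⟩, ⟨zero_le_one, le_rfl⟩⟩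
    ⟨Nat.zero_le _, Nat.le_add_right a b, hab, Nat.zero_le _, le_rfl, le_rfl⟩
    ⟨le_rfl, le_rfl, Nat.le_add_left b a, Nat.le_add_left b a, Nat.le_add_left b a, le_rfl⟩
    (fun h => by
      linear_combination (-(if h = 0 then (1 : ℝ) else 0)) * (e₁ + e₄) + (-(if h = a then (1 : ℝ) else 0)) * (e₂ + e₃))
    ⟨fun _ => validAt_giant y _ y j' 0 (a + b) hab0 hjab le_rfl,
      fun _ => validAt_giant y _ y j' a (a + b) (Nat.lt_add_of_pos_right hb) hjab le_rfl,
      fun _ => validAt_pair y _ ρ γ j' a b hlt hbj hy1 hρ hγ,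
      fun h => by
        obtain ⟨hg, _, hyg⟩ := hv₄ h
        rw [hg] at hyg ⊢
        exact validAt_mid_zero y _ j' b hb hbj hyg,
      fun _ => validAt_point y _ 1 j' b hSb, fun _ => validAt_point y _ 1 j' (a + b) hSab⟩

/-! ### The window theorem and DEC(j′) at every layer -/

/-- **BLOB-DEC(2) below the top, sizes ordered (`1 ≤ a ≤ b`).**  For floor `0 < y < 1`, gates `u, v ∈ [y, 1]` and every layer
`j′ < a + b`: DEC(j′) for the two-blob law — class G if `j′ < b`, else (`b ≤ j′`, automatically non-dominant) tied-one if `v = 1`,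
else AB or aB according to `T ≤ 2a` or `2a < T`. [this work] -/
theorem decAt_window_le (a b j' : ℕ) (u v y : ℝ) (ha : 0 < a) (hab : a ≤ b) (hjab : j' + 1 ≤ a + b)
    (hy : 0 < y) (hy1 : y < 1) (hyu : y ≤ u) (hu1 : u ≤ 1) (hyv : y ≤ v) (hv1 : v ≤ 1) :
    LawDec.DECAt y j' (a + b) (fun h => LAW2[a, u, b, v, h]) := by
  rcases le_or_gt b j' with hbj | hjb
  swap
  · exact decAt_of_giant a b j' u v y hjb (hy.le.trans hyu) hu1 hyv (hy.le.trans hyv) hv1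
  · rcases hv1.eq_or_lt with hv | hv
    · subst hv
      exact decAt_of_tied_one a b j' u y hab (hy.le.trans hyu) hu1
    · rcases le_or_gt ((a : ℝ) * u + b * v) (2 * a) with hAB | haB
      · exact decAt_classAB a b j' u v y ha hab hbj hjab hy hy1 hyu hyv hu1 hv hAB
      · exact decAt_classaB a b j' u v y ha hab hbj hjab hy hy1 hyu hyv hu1 hv haB

/-- **BLOB-DEC(2) BELOW THE TOP (any sizes `a, b ≥ 1`).**  For floor `0 < y < 1`, gates `u, v ∈ [y, 1]` and every layer `j′` with
`j′ + 1 ≤ a + b`, the law of `a·Bernoulli(u) + b·Bernoulli(v)` is DEC(j′) at floor `y`: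
`Quant.LawDec.DECAt y j′ (a+b) LAW2[a,u,b,v]`.  (Order the sizes; the law is symmetric.)  This is the window half of BLOB-DEC(2)
(BLOB-DEC2-G51) together with the dominant layers. [this work] -/
theorem decAt_window (a b j' : ℕ) (u v y : ℝ) (ha : 0 < a) (hb : 0 < b) (hjab : j' + 1 ≤ a + b)
    (hy : 0 < y) (hy1 : y < 1) (hyu : y ≤ u) (hu1 : u ≤ 1) (hyv : y ≤ v) (hv1 : v ≤ 1) :
    LawDec.DECAt y j' (a + b) (fun h => LAW2[a, u, b, v, h]) := by
  rcases le_total a b with hab | hba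
  · exact decAt_window_le a b j' u v y ha hab hjab hy hy1 hyu hu1 hyv hv1
  · have h := decAt_window_le b a j' v u y hb hba (by rwa [Nat.add_comm b a]) hy hy1 hyv hv1 hyu hu1
    have e : (fun h : ℕ => LAW2[b, v, a, u, h]) = (fun h : ℕ => LAW2[a, u, b, v, h]) := by
      funext h
      rw [Nat.add_comm b a]
      ring
    rw [e, Nat.add_comm b a] at h
    exact h

/-- **BLOB-DEC(2) AT EVERY LAYER.**  For sizes `a, b ≥ 1`, floor `0 < y < 1`, gates `u, v ∈ [y, 1]` and EVERY `j′`: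
`Quant.LawDec.DECAt y j′ (a+b) LAW2[a,u,b,v]` — below the top by `decAt_window`, at and above the top by Theorem A
(`Quant.LawDec.decAt_of_top_le`; every charged atom `h ≤ a + b` has `y·h ≤ y(a+b) ≤ au + bv`).  Conjecture `Quant.TreeDEC`'s
conclusion for two leaves under the root, at law level and including the dominant layers. [this work] -/
theorem decAt_all (a b j' : ℕ) (u v y : ℝ) (ha : 0 < a) (hb : 0 < b)
    (hy : 0 < y) (hy1 : y < 1) (hyu : y ≤ u) (hu1 : u ≤ 1) (hyv : y ≤ v) (hv1 : v ≤ 1) :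
    LawDec.DECAt y j' (a + b) (fun h => LAW2[a, u, b, v, h]) := by
  rcases le_or_gt (a + b) j' with hj | hj
  swap
  · exact decAt_window a b j' u v y ha hb hj hy hy1 hyu hu1 hyv hv1
  · have hmean : ∑ h ∈ Finset.range (a + b + 1), (h : ℝ) * (fun h => LAW2[a, u, b, v, h]) h = a * u + b * v :=
      law_mean a b u v
    refine LawDec.decAt_of_top_le (a + b) (fun h => LAW2[a, u, b, v, h])
      (fun h => law_nonneg a b u v (hy.le.trans hyu) hu1 (hy.le.trans hyv) hv1 h)
      (fun h hh => law_eq_zero_of_lt a b u v h hh) (law_mass a b u v) y hy1 ?_ j' hj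
    intro h hh
    rw [hmean]
    have ha' : (0 : ℝ) ≤ a := Nat.cast_nonneg a
    have hb' : (0 : ℝ) ≤ b := Nat.cast_nonneg b
    calc y * (h : ℝ) ≤ y * ((a : ℝ) + b) := law_pos_atom_le a b u v y hy.le h hh
      _ ≤ a * u + b * v := by nlinarith [mul_le_mul_of_nonneg_left hyu ha', mul_le_mul_of_nonneg_left hyv hb']

end BlobDec2

end Quant

end Summit.CriticalPhenomena.PercolationContinuityZ3.Theorems
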